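import Mathlib
import Summits.PneNP.PneNP.Theorems.OverlapGapAlgebraSolvableImpliesStableSectionMeanSquareFromMean
import Summits.PneNP.PneNP.Theorems.OverlapGapAlgebraSearchHardWindowRadiusLocalRung

/-!
# PneNP / OverlapGapAlgebra — crux `SolvableImpliesStableSection` (stmt-PneNP-2463):
# the mean-square engine FROM A MEAN BOUND (2/2) — filter forms and the local-rule interface

Support for crux `stmt-PneNP-2463`. Consequences of `sissMV_pathBound_of_mean` (file 1/2):

* `sissMV_concl_of_mean` / `sissMV_concl_of_mean_frequently` — an ℓ²-stable map (`s₂(n) log³ n = o(n)`)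
  violating at most `μ m` clauses of `F_k(n, ⌊α n⌋₊)` in the mean, `μ < ν`, realises the path event of
  `SolvableImpliesStableSection` at `(η, ν)` on `≥ e^{-cn}·#paths`, eventually (resp. infinitely often)
  — every `k ≥ 1`, `α, η > 0`, `c > 0`;
* `sissMV_concl_of_localMean` — the same for radius-`r` LOCAL rules (`shwRad_meanSquare`,
  `shwRad_isLittleO`): the interface through which bounded-round peeling / repair rules with a vanishing
  mean violation enter (the f-free blocks of the crux below the window).
No new definitions; axioms `propext`, `Classical.choice`, `Quot.sound`.
-/

set_option linter.dupNamespace false -- `Summit.PneNP.PneNP.…`: summit = sub-problem (D-0017)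

namespace Summit.PneNP.PneNP.Theorems

open Finset Filter Asymptotics
open scoped Classical

section FromMeanFilter

variable {m k n : ℕ}

/-- **The engine from a mean bound (eventual form).** For every `k ≥ 1`, `α, η > 0`, levels
`0 ≤ μ < ν`, every `s₂ : ℕ → ℝ` with `s₂(n) log³ n = o(n)`: if for all large `n` (`m = ⌊α n⌋₊`) some
map `g` has mean-square single-literal sensitivity `≤ s₂(n)` and violates at most `μ m` clauses in the
mean (`∑_Φ V_g(Φ) ≤ μ m·#Inst`), then for every `c > 0`, for all large `n`, some map (such a `g` itself)
realises the path event of `SolvableImpliesStableSection` at `(η, ν)` on `≥ e^{-cn}·#paths`. -/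
theorem sissMV_concl_of_mean (k : ℕ) (hk : 1 ≤ k) (α η ν μ : ℝ) (hα : 0 < α)
    (hη : 0 < η) (hμν : μ < ν) (s₂ : ℕ → ℝ)
    (hs : (fun n : ℕ => s₂ n * Real.log n ^ 3) =o[atTop] (fun n : ℕ => (n : ℝ)))
    (hsolv : ∀ᶠ n : ℕ in atTop, ∀ m : ℕ, m = ⌊α * n⌋₊ →
      ∃ g : (Fin m → Fin k → Fin n × Bool) → (Fin n → Bool),
        (∑ a : Fin m, ∑ b : Fin k, ∑ p : (Fin m → Fin k → Fin n × Bool) × (Fin n × Bool),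
          (hammingDist (g p.1) (g (Function.update p.1 a (Function.update (p.1 a) b p.2))) : ℝ) ^ 2)
          ≤ s₂ n * (((m * k : ℕ) : ℝ) * (Fintype.card (Fin m → Fin k → Fin n × Bool) * (2 * n))) ∧
        (∑ Φ : Fin m → Fin k → Fin n × Bool,
          (((univ : Finset (Fin m)).filter fun i => ∀ j, g Φ (Φ i j).1 ≠ (Φ i j).2).card : ℝ))
          ≤ μ * m * Fintype.card (Fin m → Fin k → Fin n × Bool))
    (c : ℝ) (hc : 0 < c) :
    ∀ᶠ n : ℕ in atTop, ∀ m : ℕ, m = ⌊α * n⌋₊ →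
      ∃ g : (Fin m → Fin k → Fin n × Bool) → (Fin n → Bool),
        Real.exp (-(c * n)) * Fintype.card (Fin (k + 1) → Fin m → Fin k → Fin n × Bool) ≤
        ((Finset.univ.filter fun Ψ : Fin (k + 1) → Fin m → Fin k → Fin n × Bool =>
          let P : Fin k → ℕ → Fin m → Fin k → Fin n × Bool :=
            fun r q a b => if (a : ℕ) * k + b < q then Ψ r.succ a b else Ψ r.castSucc a b
          (∀ r : Fin k, ∀ q ≤ m * k, ((Finset.univ.filter fun i : Fin m =>
            ∀ j, g (P r q) (P r q i j).1 ≠ (P r q i j).2).card : ℝ) ≤ ν * m) ∧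
          ∀ r : Fin k, ∀ q < m * k,
            (hammingDist (g (P r q)) (g (P r (q + 1))) : ℝ) ≤ η * n).card : ℝ) := by
  have hkR : (1 : ℝ) ≤ k := by exact_mod_cast hk
  have hk0 : (0 : ℝ) < k := by linarith
  have hτ : 0 < ν - μ := sub_pos.2 hμν
  -- the small constant `δ`
  obtain ⟨δ, hδpos, hδa, hδη, hδc, hδb⟩ : ∃ δ : ℝ, 0 < δ ∧
      δ ≤ 1 * (ν - μ) ^ 2 * α / (144 * k) ∧ δ ≤ η ^ 2 / (k * α) ∧
      δ ≤ c * (ν - μ) ^ 2 / (576 * k ^ 3) ∧ δ ≤ α * (ν - μ) ^ 2 / (288 * k) := by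
    refine ⟨min (1 * (ν - μ) ^ 2 * α / (144 * k))
      (min (η ^ 2 / (k * α)) (min (c * (ν - μ) ^ 2 / (576 * k ^ 3)) (α * (ν - μ) ^ 2 / (288 * k)))),
      ?_, min_le_left _ _, (min_le_right _ _).trans (min_le_left _ _),
      ((min_le_right _ _).trans (min_le_right _ _)).trans (min_le_left _ _),
      ((min_le_right _ _).trans (min_le_right _ _)).trans (min_le_right _ _)⟩
    refine lt_min ?_ (lt_min ?_ (lt_min ?_ ?_)) <;> positivity
  -- eventual conditions in `n`
  have C0 : ∀ᶠ n : ℕ in atTop, 3 ≤ n := eventually_ge_atTop 3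
  have C1 : ∀ᶠ n : ℕ in atTop, s₂ n * Real.log n ^ 3 ≤ δ * n := by
    filter_upwards [hs.def hδpos] with n hn
    rw [Real.norm_eq_abs, Real.norm_eq_abs, Nat.abs_cast] at hn
    exact (le_abs_self _).trans hn
  have C3 : ∀ᶠ n : ℕ in atTop, (16 * k + 1 * (ν - μ) ^ 2) * 2 / (1 * (ν - μ) ^ 2 * α) ≤ (n : ℝ) :=
    tendsto_natCast_atTop_atTop.eventually_ge_atTop _
  have C4 : ∀ᶠ n : ℕ in atTop, (1 + 64 * k ^ 3 / (ν - μ) ^ 2 + 8 * k) * Real.log n ≤ c * n / 2 := by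
    have hlo := Real.isLittleO_log_id_atTop.comp_tendsto tendsto_natCast_atTop_atTop
    have hK : (0 : ℝ) < 1 + 64 * k ^ 3 / (ν - μ) ^ 2 + 8 * k := by positivity
    have hpos : 0 < c / (2 * (1 + 64 * k ^ 3 / (ν - μ) ^ 2 + 8 * k)) := by positivity
    filter_upwards [hlo.def hpos] with n hn
    simp only [Function.comp_apply, id_eq, Real.norm_eq_abs, Nat.abs_cast] at hn
    have h1 : Real.log n ≤ c / (2 * (1 + 64 * k ^ 3 / (ν - μ) ^ 2 + 8 * k)) * n :=
      (le_abs_self _).trans hn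
    calc (1 + 64 * k ^ 3 / (ν - μ) ^ 2 + 8 * k) * Real.log n
        ≤ (1 + 64 * k ^ 3 / (ν - μ) ^ 2 + 8 * k) * (c / (2 * (1 + 64 * k ^ 3 / (ν - μ) ^ 2 + 8 * k)) * n) :=
          mul_le_mul_of_nonneg_left h1 hK.le
      _ = c * n / 2 := by field_simp
  have C5 : ∀ᶠ n : ℕ in atTop,
      2 * (32 * k ^ 3 / (ν - μ) ^ 2 + 4 * k + 1 + k ^ 2) / (k ^ 2 * α) ≤ (n : ℝ) :=
    tendsto_natCast_atTop_atTop.eventually_ge_atTop _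
  have C7 : ∀ᶠ n : ℕ in atTop, α ^ 2 * Real.exp (α * k * Real.exp 2) ≤ (n : ℝ) :=
    tendsto_natCast_atTop_atTop.eventually_ge_atTop _
  have C8 : ∀ᶠ n : ℕ in atTop, α * (ν - μ) ^ 2 * Real.exp (α * k * Real.exp 2) ≤ (n : ℝ) :=
    tendsto_natCast_atTop_atTop.eventually_ge_atTop _
  filter_upwards [hsolv, C0, C1, C3, C4, C5, C7, C8] with n hn hn3 hC1 hC3 hC4 hC5 hC7 hC8 m hm
  obtain ⟨g, hg, hmean⟩ := hn m hm
  refine ⟨g, ?_⟩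
  -- a nonnegative sensitivity level `s' ≥ s₂ n`
  obtain ⟨s', hs'0, hs'ge, hC1'⟩ : ∃ s' : ℝ, 0 ≤ s' ∧ s₂ n ≤ s' ∧ s' * Real.log n ^ 3 ≤ δ * n := by
    refine ⟨max (s₂ n) 0, le_max_right _ _, le_max_left _ _, ?_⟩
    rcases le_or_gt 0 (s₂ n) with h | h
    · rw [max_eq_left h]; exact hC1
    · rw [max_eq_right h.le, zero_mul]; positivity
  have hX0 : 0 ≤ ((m * k : ℕ) : ℝ) * ((Fintype.card (Fin m → Fin k → Fin n × Bool) : ℝ) * (2 * n)) := by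
    positivity
  have hg' := hg.trans (mul_le_mul_of_nonneg_right hs'ge hX0)
  exact sissMV_pathBound_of_mean k hk α η ν μ c δ s' hα hη hμν hc hs'0 hδa hδη hδc hδb n m hn3 hC1'
    hC3 hC4 hC5 hC7 hC8 hm g hg' hmean

/-- **The engine from a mean bound (frequent form).** As `sissMV_concl_of_mean`, with "for infinitely
many `n`" in hypothesis and conclusion — the quantifier shape of the crux. -/
theorem sissMV_concl_of_mean_frequently (k : ℕ) (hk : 1 ≤ k) (α η ν μ : ℝ) (hα : 0 < α)
    (hη : 0 < η) (hμν : μ < ν) (s₂ : ℕ → ℝ)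
    (hs : (fun n : ℕ => s₂ n * Real.log n ^ 3) =o[atTop] (fun n : ℕ => (n : ℝ)))
    (hsolv : ∃ᶠ n : ℕ in atTop, ∀ m : ℕ, m = ⌊α * n⌋₊ →
      ∃ g : (Fin m → Fin k → Fin n × Bool) → (Fin n → Bool),
        (∑ a : Fin m, ∑ b : Fin k, ∑ p : (Fin m → Fin k → Fin n × Bool) × (Fin n × Bool),
          (hammingDist (g p.1) (g (Function.update p.1 a (Function.update (p.1 a) b p.2))) : ℝ) ^ 2)
          ≤ s₂ n * (((m * k : ℕ) : ℝ) * (Fintype.card (Fin m → Fin k → Fin n × Bool) * (2 * n))) ∧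
        (∑ Φ : Fin m → Fin k → Fin n × Bool,
          (((univ : Finset (Fin m)).filter fun i => ∀ j, g Φ (Φ i j).1 ≠ (Φ i j).2).card : ℝ))
          ≤ μ * m * Fintype.card (Fin m → Fin k → Fin n × Bool))
    (c : ℝ) (hc : 0 < c) :
    ∃ᶠ n : ℕ in atTop, ∀ m : ℕ, m = ⌊α * n⌋₊ →
      ∃ g : (Fin m → Fin k → Fin n × Bool) → (Fin n → Bool),
        Real.exp (-(c * n)) * Fintype.card (Fin (k + 1) → Fin m → Fin k → Fin n × Bool) ≤
        ((Finset.univ.filter fun Ψ : Fin (k + 1) → Fin m → Fin k → Fin n × Bool =>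
          let P : Fin k → ℕ → Fin m → Fin k → Fin n × Bool :=
            fun r q a b => if (a : ℕ) * k + b < q then Ψ r.succ a b else Ψ r.castSucc a b
          (∀ r : Fin k, ∀ q ≤ m * k, ((Finset.univ.filter fun i : Fin m =>
            ∀ j, g (P r q) (P r q i j).1 ≠ (P r q i j).2).card : ℝ) ≤ ν * m) ∧
          ∀ r : Fin k, ∀ q < m * k,
            (hammingDist (g (P r q)) (g (P r (q + 1))) : ℝ) ≤ η * n).card : ℝ) := by
  have hkR : (1 : ℝ) ≤ k := by exact_mod_cast hk
  have hk0 : (0 : ℝ) < k := by linarith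
  have hτ : 0 < ν - μ := sub_pos.2 hμν
  obtain ⟨δ, hδpos, hδa, hδη, hδc, hδb⟩ : ∃ δ : ℝ, 0 < δ ∧
      δ ≤ 1 * (ν - μ) ^ 2 * α / (144 * k) ∧ δ ≤ η ^ 2 / (k * α) ∧
      δ ≤ c * (ν - μ) ^ 2 / (576 * k ^ 3) ∧ δ ≤ α * (ν - μ) ^ 2 / (288 * k) := by
    refine ⟨min (1 * (ν - μ) ^ 2 * α / (144 * k))
      (min (η ^ 2 / (k * α)) (min (c * (ν - μ) ^ 2 / (576 * k ^ 3)) (α * (ν - μ) ^ 2 / (288 * k)))),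
      ?_, min_le_left _ _, (min_le_right _ _).trans (min_le_left _ _),
      ((min_le_right _ _).trans (min_le_right _ _)).trans (min_le_left _ _),
      ((min_le_right _ _).trans (min_le_right _ _)).trans (min_le_right _ _)⟩
    refine lt_min ?_ (lt_min ?_ (lt_min ?_ ?_)) <;> positivity
  have C0 : ∀ᶠ n : ℕ in atTop, 3 ≤ n := eventually_ge_atTop 3
  have C1 : ∀ᶠ n : ℕ in atTop, s₂ n * Real.log n ^ 3 ≤ δ * n := by
    filter_upwards [hs.def hδpos] with n hn
    rw [Real.norm_eq_abs, Real.norm_eq_abs, Nat.abs_cast] at hn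
    exact (le_abs_self _).trans hn
  have C3 : ∀ᶠ n : ℕ in atTop, (16 * k + 1 * (ν - μ) ^ 2) * 2 / (1 * (ν - μ) ^ 2 * α) ≤ (n : ℝ) :=
    tendsto_natCast_atTop_atTop.eventually_ge_atTop _
  have C4 : ∀ᶠ n : ℕ in atTop, (1 + 64 * k ^ 3 / (ν - μ) ^ 2 + 8 * k) * Real.log n ≤ c * n / 2 := by
    have hlo := Real.isLittleO_log_id_atTop.comp_tendsto tendsto_natCast_atTop_atTop
    have hK : (0 : ℝ) < 1 + 64 * k ^ 3 / (ν - μ) ^ 2 + 8 * k := by positivity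
    have hpos : 0 < c / (2 * (1 + 64 * k ^ 3 / (ν - μ) ^ 2 + 8 * k)) := by positivity
    filter_upwards [hlo.def hpos] with n hn
    simp only [Function.comp_apply, id_eq, Real.norm_eq_abs, Nat.abs_cast] at hn
    have h1 : Real.log n ≤ c / (2 * (1 + 64 * k ^ 3 / (ν - μ) ^ 2 + 8 * k)) * n :=
      (le_abs_self _).trans hn
    calc (1 + 64 * k ^ 3 / (ν - μ) ^ 2 + 8 * k) * Real.log n
        ≤ (1 + 64 * k ^ 3 / (ν - μ) ^ 2 + 8 * k) * (c / (2 * (1 + 64 * k ^ 3 / (ν - μ) ^ 2 + 8 * k)) * n) :=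
          mul_le_mul_of_nonneg_left h1 hK.le
      _ = c * n / 2 := by field_simp
  have C5 : ∀ᶠ n : ℕ in atTop,
      2 * (32 * k ^ 3 / (ν - μ) ^ 2 + 4 * k + 1 + k ^ 2) / (k ^ 2 * α) ≤ (n : ℝ) :=
    tendsto_natCast_atTop_atTop.eventually_ge_atTop _
  have C7 : ∀ᶠ n : ℕ in atTop, α ^ 2 * Real.exp (α * k * Real.exp 2) ≤ (n : ℝ) :=
    tendsto_natCast_atTop_atTop.eventually_ge_atTop _
  have C8 : ∀ᶠ n : ℕ in atTop, α * (ν - μ) ^ 2 * Real.exp (α * k * Real.exp 2) ≤ (n : ℝ) :=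
    tendsto_natCast_atTop_atTop.eventually_ge_atTop _
  have hev : ∀ᶠ n : ℕ in atTop, 3 ≤ n ∧ s₂ n * Real.log n ^ 3 ≤ δ * n ∧
      (16 * k + 1 * (ν - μ) ^ 2) * 2 / (1 * (ν - μ) ^ 2 * α) ≤ (n : ℝ) ∧
      (1 + 64 * k ^ 3 / (ν - μ) ^ 2 + 8 * k) * Real.log n ≤ c * n / 2 ∧
      2 * (32 * k ^ 3 / (ν - μ) ^ 2 + 4 * k + 1 + k ^ 2) / (k ^ 2 * α) ≤ (n : ℝ) ∧
      α ^ 2 * Real.exp (α * k * Real.exp 2) ≤ (n : ℝ) ∧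
      α * (ν - μ) ^ 2 * Real.exp (α * k * Real.exp 2) ≤ (n : ℝ) := by
    filter_upwards [C0, C1, C3, C4, C5, C7, C8] with n h0 h1 h3 h4 h5 h7 h8
    exact ⟨h0, h1, h3, h4, h5, h7, h8⟩
  refine (hsolv.and_eventually hev).mono ?_
  rintro n ⟨hn, hn3, hC1, hC3, hC4, hC5, hC7, hC8⟩ m hm
  obtain ⟨g, hg, hmean⟩ := hn m hm
  refine ⟨g, ?_⟩
  obtain ⟨s', hs'0, hs'ge, hC1'⟩ : ∃ s' : ℝ, 0 ≤ s' ∧ s₂ n ≤ s' ∧ s' * Real.log n ^ 3 ≤ δ * n := by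
    refine ⟨max (s₂ n) 0, le_max_right _ _, le_max_left _ _, ?_⟩
    rcases le_or_gt 0 (s₂ n) with h | h
    · rw [max_eq_left h]; exact hC1
    · rw [max_eq_right h.le, zero_mul]; positivity
  have hX0 : 0 ≤ ((m * k : ℕ) : ℝ) * ((Fintype.card (Fin m → Fin k → Fin n × Bool) : ℝ) * (2 * n)) := by
    positivity
  have hg' := hg.trans (mul_le_mul_of_nonneg_right hs'ge hX0)
  exact sissMV_pathBound_of_mean k hk α η ν μ c δ s' hα hη hμν hc hs'0 hδa hδη hδc hδb n m hn3 hC1'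
    hC3 hC4 hC5 hC7 hC8 hm g hg' hmean

/-- **Radius-`r` local rules with a small mean violation are stable sections.** For every `k ≥ 1`,
`α, η > 0`, levels `μ < ν` and every radius `r`: if for all large `n` (`m = ⌊α n⌋₊`) some radius-`r`
local map (hypothesis `hloc` of `shwRad_hamming_le`: the output bit at `v` is any label-dependent
function of the labelled clauses seen by `v` within radius `r`) violates at most `μ m` clauses in the
mean, then for every `c > 0`, for all large `n`, the path event of `SolvableImpliesStableSection` at
`(η, ν)` holds on `≥ e^{-cn}·#paths` (with that map as the section). -/
theorem sissMV_concl_of_localMean (k r : ℕ) (hk : 1 ≤ k) (α η ν μ : ℝ) (hα : 0 < α)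
    (hη : 0 < η) (hμν : μ < ν)
    (hloc_mean : ∀ᶠ n : ℕ in atTop, ∀ m : ℕ, m = ⌊α * n⌋₊ →
      ∃ g : (Fin m → Fin k → Fin n × Bool) → (Fin n → Bool),
        (∀ (Φ Φ' : Fin m → Fin k → Fin n × Bool) (v : Fin n),
          (∀ i : Fin m,
            ((∃ j : Fin k, ∃ p : ℕ → Fin n, p 0 = v ∧ p r = (Φ i j).1 ∧ ∀ s, s < r → (p s = p (s + 1) ∨
            ∃ i' : Fin m, ∃ j₁ j₂ : Fin k, (Φ i' j₁).1 = p s ∧ (Φ i' j₂).1 = p (s + 1))) ∨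
             (∃ j : Fin k, ∃ p : ℕ → Fin n, p 0 = v ∧ p r = (Φ' i j).1 ∧ ∀ s, s < r → (p s = p (s + 1) ∨
            ∃ i' : Fin m, ∃ j₁ j₂ : Fin k, (Φ' i' j₁).1 = p s ∧ (Φ' i' j₂).1 = p (s + 1)))) →
            Φ i = Φ' i) →
          g Φ v = g Φ' v) ∧
        (∑ Φ : Fin m → Fin k → Fin n × Bool,
          (((univ : Finset (Fin m)).filter fun i => ∀ j, g Φ (Φ i j).1 ≠ (Φ i j).2).card : ℝ))
          ≤ μ * m * Fintype.card (Fin m → Fin k → Fin n × Bool))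
    (c : ℝ) (hc : 0 < c) :
    ∀ᶠ n : ℕ in atTop, ∀ m : ℕ, m = ⌊α * n⌋₊ →
      ∃ g : (Fin m → Fin k → Fin n × Bool) → (Fin n → Bool),
        Real.exp (-(c * n)) * Fintype.card (Fin (k + 1) → Fin m → Fin k → Fin n × Bool) ≤
        ((Finset.univ.filter fun Ψ : Fin (k + 1) → Fin m → Fin k → Fin n × Bool =>
          let P : Fin k → ℕ → Fin m → Fin k → Fin n × Bool :=
            fun r q a b => if (a : ℕ) * k + b < q then Ψ r.succ a b else Ψ r.castSucc a b
          (∀ r : Fin k, ∀ q ≤ m * k, ((Finset.univ.filter fun i : Fin m =>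
            ∀ j, g (P r q) (P r q i j).1 ≠ (P r q i j).2).card : ℝ) ≤ ν * m) ∧
          ∀ r : Fin k, ∀ q < m * k,
            (hammingDist (g (P r q)) (g (P r (q + 1))) : ℝ) ≤ η * n).card : ℝ) := by
  refine sissMV_concl_of_mean k hk α η ν μ hα hη hμν
    (fun n : ℕ => (2 * k * (3 * k * Real.log n + k + 1) ^ r) ^ 2 + 1) (shwRad_isLittleO k r) ?_ c hc
  have hlargeE : ∀ᶠ n : ℕ in atTop, Real.exp (α * k * Real.exp 2) ≤ (n : ℝ) ^ 3 :=
    ((tendsto_pow_atTop (by norm_num : (3 : ℕ) ≠ 0)).comp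
      tendsto_natCast_atTop_atTop).eventually_ge_atTop _
  filter_upwards [hloc_mean, hlargeE, eventually_ge_atTop 1] with n hn hlarge hn1 m hm
  obtain ⟨g, hloc, hmean⟩ := hn m hm
  have hm_le : (m : ℝ) ≤ α * n := by rw [hm]; exact Nat.floor_le (by positivity)
  exact ⟨g, shwRad_meanSquare (r := r) hn1 α hα.le hm_le hlarge g hloc, hmean⟩

end FromMeanFilter

end Summit.PneNP.PneNP.Theorems
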